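/-
Copyright: statement-level skeleton of a published paper (lit-balaban cell, Phase-2 proof seat p39 gen 4). No proof claims
beyond what the kernel checks below.
-/
import Literature.MathematicalPhysics.QuantumFieldTheory.Balaban1983to89.B3CxiUniformBound
import Literature.MathematicalPhysics.QuantumFieldTheory.Balaban1983to89.B3CxiBesselDifference

/-!
# B3 — T. Bałaban, *(Higgs)₂,₃ quantum fields in a finite volume. III. Renormalization*, CMP **88** (1983) 411–445
[Balaban1983Higgs3], p. 437: the printed clause *"and the corresponding inequalities for derivatives"* for the free propagator
C^ξ = (−Δ^ξ+1)^{−1} on ξℤ³ — FILE 2/3: the DIFFERENCE KERNEL e^{−t}[Q(θt)(y+e_ν) − Q(θt)(y)] of the Poissonized representation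
and its pointwise bound in the two regimes (d = 3)

statement-level skeleton of published theorems with citation tags; proofs where landed; nothing here is a claim about
the Yang–Mills mass gap

PDF held: `paper:balaban1983-higgs-2-3-quantum-fields-finite-volume` (journal page = PDF page + 410), p. 437 [PDF 27].
WHAT IS REPRODUCED: kernel infrastructure for row **B3.Eq3.11-3.17** of `HOME/lit-balaban-r15/ROWS-B3.md` (reader/typer r15,
fold owner of B3) — the p. 437 sentence *"Using the inequalities |C^ξ(y − y′)| ≦ O(1)e^{−½|y−y′|}/|y − y′|, |G^ξ_{j″}(0; y, y′)| ≦
O(1)e^{−δ₀|y−y′|}/|y − y′|, and the corresponding inequalities for derivatives, we can estimate (3.16) by a constant"* — here the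
middle file of the proof of the DERIVATIVE INEQUALITY FOR THE FREE PROPAGATOR C^ξ (file 3: `B3CxiDerivativeBound`,
|∂^ξ_νC^ξ(y)| ≤ 14400·e^{−ξ|y|/2}/(ξ|y|)² on ξℤ³ uniformly in 0 < ξ ≤ 1).  Unit `lit-balaban-p39-g4` (Phase-2 proof seat p39, gen 4),
HOME `run/shared/lean/pub/lit-balaban/`.  By this seat's gen-3 Poissonization (`B3CxiPoissonization.Cxi_eq_integral`),
C^ξ(y+e_ν) − C^ξ(y) = θξ²ξ^{−3}∫₀^∞e^{−t}[Q(θt)(y+e_ν) − Q(θt)(y)]dt with Q(s)(y) = Π_μG(s,y_μ), θ = (6+ξ²)^{−1}, and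
Q(s)(y+e_ν) − Q(s)(y) = [G(s,y_ν+1) − G(s,y_ν)]·Π_{μ≠ν}G(s,y_μ) (`Q_succ_sub`).  §1: the DIFFERENCE factor on ℤ obeys the tilted
bound of file 1 (`B3CxiBesselDifference.abs_besselF_sub_succ_le`) and its (n+1)-tilted twin proved here
(`abs_besselF_sub_succ_le_succ`): **|G(s,n+1) − G(s,n)| ≤ (2/√(1+s))e^{2s cosh a − a|n|}(5/(4√(1+s)) + (e^a − 1))** for s, a ≥ 0, n ∈ ℤ
(`abs_G_succ_sub_le`) — the undifferentiated factor 2(1+s)^{−1/2}e^{2s cosh a − a|n|} of `besselF_le` times the EXTRA FACTOR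
5/(4√(1+s)) + (e^a − 1).  §2: hence |ΔQ(s)(y)| ≤ (2/√(1+s))^d·exp(Σ_μ(2s cosh a_μ − a_μ|y_μ|))·(5/(4√(1+s)) + e^{a_ν} − 1) for tilts
a_μ ≥ 0 (`dQ_le_tilt`), and in the two regimes of `B3CxiUniformBound` (Gaussian tilts a_μ = 5|y_μ|/(14s) when 5|y|_∞ ≤ 28s, where
e^{a_ν} − 1 ≤ (8/7)|y_ν|/s by convexity of exp on [0,2]; tilt 2 at a largest coordinate otherwise, extra factor ≤ 5/4 + e² − 1 ≤ 8):
|ΔQ(s)(y)| ≤ (2/√(1+s))³[e^{6s − (5/28)|y|²/s}(5/(4√(1+s)) + (8/7)|y_ν|/s) + 8e^{6s − |y|_∞}] (`dQ_three_le`).  §3: with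
e^{−t}e^{6θt} = e^{−ξ²θt} and completing the square as in gen 3, the pointwise bound of the difference integrand
**|e^{−t}ΔQ(θt)(y)| ≤ e^{−ξ|y|/2}[10(θt)^{−2} + (64/7)|y_ν|(θt)^{−5/2}]e^{−(|y|²/14)/(θt)} + 8e^{−|y|_∞}(2/√(1+θt))³**
(`abs_integrand_succ_sub_three_le`) — one power (θt)^{−1/2} resp. (θt)^{−1} more than the undifferentiated integrand, which is what
turns the 1/|y| of `Cxi_three_le` into 1/|y|² in file 3.  Mathlib + the cited tree files only; no new definitions; no named facts.
-/

open scoped BigOperators Topology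
open Real MeasureTheory Set Filter

namespace Literature.MathematicalPhysics.QuantumFieldTheory.Balaban1983to89.B3CxiDifferenceKernel

open B3Sect3VectorSelfEnergy B3CxiPropagator B3CxiBesselKernel B3CxiPoissonization B3CxiUniformBound B3CxiBesselDifference

noncomputable section

variable {d : ℕ} {ξ : ℝ}

/-! ## 1. The one-dimensional difference factor on ℤ: |G(s,n+1) − G(s,n)| ≤ (2/√(1+s))e^{2s cosh a − a|n|}(5/(4√(1+s)) + e^a − 1) -/

section OneDim

variable {s a : ℝ}

/-- kernel: a ≤ e^a − 1. [folklore] -/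
private theorem self_le_exp_sub_one (a : ℝ) : a ≤ Real.exp a - 1 := by linarith [Real.add_one_le_exp a]

/-- kernel (the (n+1)-tilted twin of `B3CxiBesselDifference.abs_besselF_sub_succ_mul_exp_le`): for s ≥ 0, a ≥ 0,
|F(s,n) − F(s,n+1)|·e^{a(n+1)} ≤ e^{2s cosh a}·((5/2)/(1+s) + 2(e^a − 1)/√(1+s)) (after tilting by e^{a(n+1)} the j-sum is
e^{λ₁+λ₂}Σ_j Poi_{λ₁}(j)[e^aPoi_{λ₂}(j+n) − Poi_{λ₂}(j+n+1)]). [cite: Balaban1983Higgs3, (3.16) p.437] -/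
theorem abs_besselF_sub_succ_mul_exp_succ_le (hs : 0 ≤ s) (ha : 0 ≤ a) (n : ℕ) :
    |besselF s n - besselF s (n + 1)| * Real.exp (a * ((n + 1 : ℕ) : ℝ)) ≤
      Real.exp (2 * s * Real.cosh a) * (5 / 2 / (1 + s) + 2 * (Real.exp a - 1) / Real.sqrt (1 + s)) := by
  set lam1 : ℝ := s * Real.exp (-a) with hlam1
  set lam2 : ℝ := s * Real.exp a with hlam2
  set M : ℝ := Real.exp (2 * s * Real.cosh a) * (5 / 2 / (1 + s) + 2 * (Real.exp a - 1) / Real.sqrt (1 + s)) with hM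
  have hl1 : 0 ≤ lam1 := by positivity
  have hl2 : 0 ≤ lam2 := by positivity
  have hcosh : lam1 + lam2 = 2 * s * Real.cosh a := by rw [hlam1, hlam2, Real.cosh_eq]; ring
  have h1s : 0 < 1 + s := by linarith
  have hsq : 0 < Real.sqrt (1 + s) := Real.sqrt_pos.2 h1s
  have hea : 0 ≤ Real.exp a - 1 := by linarith [Real.one_le_exp ha]
  -- termwise identity and bound
  have hpt : ∀ j, |(besselTerm s n j - besselTerm s (n + 1) j) * Real.exp (a * ((n + 1 : ℕ) : ℝ))| ≤ M * poissonPMF lam1 j := by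
    intro j
    have h1 := besselTerm_mul_exp s a n j
    have h2 := besselTerm_mul_exp s a (n + 1) j
    have h3 : besselTerm s n j * Real.exp (a * ((n + 1 : ℕ) : ℝ)) =
        Real.exp a * (besselTerm s n j * Real.exp (a * n)) := by
      rw [mul_comm (Real.exp a), mul_assoc, ← Real.exp_add]
      congr 2; push_cast; ring
    have hid : (besselTerm s n j - besselTerm s (n + 1) j) * Real.exp (a * ((n + 1 : ℕ) : ℝ)) =
        Real.exp (2 * s * Real.cosh a) * poissonPMF lam1 j *
          (Real.exp a * poissonPMF lam2 (j + n) - poissonPMF lam2 (j + (n + 1))) := by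
      rw [sub_mul, h3, h1, h2, ← hlam1, ← hlam2, hcosh]; ring
    rw [hid, abs_mul, abs_mul, abs_of_pos (Real.exp_pos _), abs_of_nonneg (poissonPMF_nonneg hl1 j)]
    have hbr : |Real.exp a * poissonPMF lam2 (j + n) - poissonPMF lam2 (j + (n + 1))| ≤
        5 / 2 / (1 + s) + 2 * (Real.exp a - 1) / Real.sqrt (1 + s) := by
      have e : Real.exp a * poissonPMF lam2 (j + n) - poissonPMF lam2 (j + (n + 1)) =
          -(poissonPMF lam2 (j + n + 1) - poissonPMF lam2 (j + n)) + (Real.exp a - 1) * poissonPMF lam2 (j + n) := by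
        rw [← add_assoc]; ring
      rw [e]
      refine (abs_add_le _ _).trans (add_le_add ?_ ?_)
      · rw [abs_neg]
        refine (abs_poissonPMF_succ_sub_le hl2 (j + n)).trans ?_
        refine div_le_div_of_nonneg_left (by norm_num) h1s ?_
        have : s ≤ lam2 := by rw [hlam2]; exact le_mul_of_one_le_right hs (Real.one_le_exp ha)
        linarith
      · rw [abs_mul, abs_of_nonneg hea, abs_of_nonneg (poissonPMF_nonneg hl2 _)]
        have hP2 : poissonPMF lam2 (j + n) ≤ 2 / Real.sqrt (1 + s) := by
          refine (poissonPMF_le hl2 _).trans ?_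
          refine div_le_div_of_nonneg_left (by norm_num) hsq (Real.sqrt_le_sqrt ?_)
          have : s ≤ lam2 := by rw [hlam2]; exact le_mul_of_one_le_right hs (Real.one_le_exp ha)
          linarith
        calc (Real.exp a - 1) * poissonPMF lam2 (j + n) ≤ (Real.exp a - 1) * (2 / Real.sqrt (1 + s)) :=
              mul_le_mul_of_nonneg_left hP2 hea
          _ = 2 * (Real.exp a - 1) / Real.sqrt (1 + s) := by ring
    calc Real.exp (2 * s * Real.cosh a) * poissonPMF lam1 j *
          |Real.exp a * poissonPMF lam2 (j + n) - poissonPMF lam2 (j + (n + 1))|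
        ≤ Real.exp (2 * s * Real.cosh a) * poissonPMF lam1 j *
          (5 / 2 / (1 + s) + 2 * (Real.exp a - 1) / Real.sqrt (1 + s)) :=
          mul_le_mul_of_nonneg_left hbr (mul_nonneg (Real.exp_pos _).le (poissonPMF_nonneg hl1 j))
      _ = M * poissonPMF lam1 j := by rw [hM]; ring
  have hL : HasSum (fun j => (besselTerm s n j - besselTerm s (n + 1) j) * Real.exp (a * ((n + 1 : ℕ) : ℝ)))
      ((besselF s n - besselF s (n + 1)) * Real.exp (a * ((n + 1 : ℕ) : ℝ))) :=
    ((hasSum_besselF hs n).sub (hasSum_besselF hs (n + 1))).mul_right _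
  have hR : HasSum (fun j => M * poissonPMF lam1 j) M := by
    have h := (hasSum_poissonPMF hl1).mul_left M
    rwa [mul_one] at h
  have hup := hasSum_le (fun j => (le_abs_self _).trans (hpt j)) hL hR
  have hlo := hasSum_le (fun j => (neg_le_abs _).trans (hpt j)) hL.neg hR
  have h : |(besselF s n - besselF s (n + 1)) * Real.exp (a * ((n + 1 : ℕ) : ℝ))| ≤ M := abs_le.mpr ⟨by linarith, hup⟩
  rwa [abs_mul, abs_of_pos (Real.exp_pos _)] at h

/-- kernel: |F(s,n) − F(s,n+1)| ≤ e^{2s cosh a − a(n+1)}·((5/2)/(1+s) + 2(e^a − 1)/√(1+s)) — the tilt placed at the LARGER index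
n+1. [cite: Balaban1983Higgs3, (3.16) p.437] -/
theorem abs_besselF_sub_succ_le_succ (hs : 0 ≤ s) (ha : 0 ≤ a) (n : ℕ) :
    |besselF s n - besselF s (n + 1)| ≤
      Real.exp (2 * s * Real.cosh a - a * ((n + 1 : ℕ) : ℝ)) * (5 / 2 / (1 + s) + 2 * (Real.exp a - 1) / Real.sqrt (1 + s)) := by
  have h := abs_besselF_sub_succ_mul_exp_succ_le hs ha n
  rw [Real.exp_sub, div_mul_eq_mul_div, le_div_iff₀ (Real.exp_pos _)]
  exact h

/-- **The difference factor on ℤ**: for s ≥ 0, a ≥ 0 and every n ∈ ℤ,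
|G(s,n+1) − G(s,n)| ≤ (2/√(1+s))·e^{2s cosh a − a|n|}·(5/(4√(1+s)) + (e^a − 1)) (G(s,n) = F(s,|n|); for n ≥ 0 this is file 1's
`abs_besselF_sub_succ_le` with a ≤ e^a − 1, for n ≤ −1 the (|n|)-tilted twin `abs_besselF_sub_succ_le_succ`).
[cite: Balaban1983Higgs3, (3.16) p.437] -/
theorem abs_G_succ_sub_le (hs : 0 ≤ s) (ha : 0 ≤ a) (n : ℤ) :
    |G s (n + 1) - G s n| ≤
      2 / Real.sqrt (1 + s) * Real.exp (2 * s * Real.cosh a - a * (n.natAbs : ℝ)) *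
        (5 / (4 * Real.sqrt (1 + s)) + (Real.exp a - 1)) := by
  have h1s : 0 < 1 + s := by linarith
  have hsq : 0 < Real.sqrt (1 + s) := Real.sqrt_pos.2 h1s
  have hsq2 : Real.sqrt (1 + s) ^ 2 = 1 + s := Real.sq_sqrt h1s.le
  have hea : a ≤ Real.exp a - 1 := self_le_exp_sub_one a
  -- the common reshaping: e^{E}·((5/2)/(1+s) + 2X/√(1+s)) = (2/√(1+s))e^{E}(5/(4√(1+s)) + X)
  have reshape : ∀ E X : ℝ, Real.exp E * (5 / 2 / (1 + s) + 2 * X / Real.sqrt (1 + s)) =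
      2 / Real.sqrt (1 + s) * Real.exp E * (5 / (4 * Real.sqrt (1 + s)) + X) := by
    intro E X
    set w := Real.sqrt (1 + s) with hw
    rw [← hsq2]
    field_simp
    ring
  unfold G
  rcases le_or_gt 0 n with hn | hn
  · -- n ≥ 0: |F(k+1) − F(k)| with k = |n|
    have hk : (n + 1).natAbs = n.natAbs + 1 := by omega
    rw [hk, abs_sub_comm]
    refine (abs_besselF_sub_succ_le hs ha n.natAbs).trans ?_
    rw [reshape]
    have hpos : 0 ≤ 2 / Real.sqrt (1 + s) * Real.exp (2 * s * Real.cosh a - a * (n.natAbs : ℝ)) := by positivity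
    exact mul_le_mul_of_nonneg_left (by linarith) hpos
  · -- n ≤ −1: |F(k) − F(k+1)| with k = |n+1|, k+1 = |n|
    have hk : n.natAbs = (n + 1).natAbs + 1 := by omega
    rw [hk]
    refine (abs_besselF_sub_succ_le_succ hs ha (n + 1).natAbs).trans ?_
    rw [reshape]

end OneDim

/-! ## 2. The difference of the separated kernel, ΔQ(s)(y) = Q(s)(y+e_ν) − Q(s)(y), with tilts and in the two regimes (d = 3) -/

/-- kernel: Q(s)(y+e_ν) − Q(s)(y) = (G(s,y_ν+1) − G(s,y_ν))·Π_{μ≠ν}G(s,y_μ). [cite: Balaban1983Higgs3, (3.16) p.437] -/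
theorem Q_succ_sub (s : ℝ) (y : ZSite d) (ν : Fin d) :
    Q s (y + unitVec ν) - Q s y = (G s (y ν + 1) - G s (y ν)) * ∏ μ ∈ Finset.univ.erase ν, G s (y μ) := by
  have h1 := Q_shift s y ν 1
  rw [one_smul] at h1
  have h2 : Q s y = G s (y ν) * ∏ μ ∈ Finset.univ.erase ν, G s (y μ) := by
    unfold Q
    rw [Finset.mul_prod_erase Finset.univ (fun μ => G s (y μ)) (Finset.mem_univ ν)]
  rw [h1, h2]
  ring

/-- kernel: |ΔQ(s)(y)| ≤ (2/√(1+s))^d·exp(Σ_μ(2s cosh a_μ − a_μ|y_μ|))·(5/(4√(1+s)) + (e^{a_ν} − 1)) for tilts a_μ ≥ 0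
(`abs_G_succ_sub_le` on the ν-factor, `besselF_le` on the others). [cite: Balaban1983Higgs3, (3.16) p.437] -/
theorem dQ_le_tilt {s : ℝ} (hs : 0 ≤ s) (y : ZSite d) (ν : Fin d) (a : Fin d → ℝ) (ha : ∀ μ, 0 ≤ a μ) :
    |Q s (y + unitVec ν) - Q s y| ≤ (2 / Real.sqrt (1 + s)) ^ d *
      Real.exp (∑ μ, (2 * s * Real.cosh (a μ) - a μ * ((y μ).natAbs : ℝ))) *
        (5 / (4 * Real.sqrt (1 + s)) + (Real.exp (a ν) - 1)) := by
  classical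
  set X : Fin d → ℝ := fun μ => 2 / Real.sqrt (1 + s) * Real.exp (2 * s * Real.cosh (a μ) - a μ * ((y μ).natAbs : ℝ))
    with hX
  have hXnn : ∀ μ, 0 ≤ X μ := fun μ => by positivity
  have hextra : 0 ≤ 5 / (4 * Real.sqrt (1 + s)) + (Real.exp (a ν) - 1) := by
    have := Real.one_le_exp (ha ν); positivity
  rw [Q_succ_sub, abs_mul]
  have hν : |G s (y ν + 1) - G s (y ν)| ≤ X ν * (5 / (4 * Real.sqrt (1 + s)) + (Real.exp (a ν) - 1)) :=
    abs_G_succ_sub_le hs (ha ν) (y ν)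
  have hrest : |∏ μ ∈ Finset.univ.erase ν, G s (y μ)| ≤ ∏ μ ∈ Finset.univ.erase ν, X μ := by
    rw [Finset.abs_prod]
    refine Finset.prod_le_prod (fun μ _ => abs_nonneg _) fun μ _ => ?_
    rw [abs_of_nonneg (G_nonneg hs _)]
    exact besselF_le hs (ha μ) _
  have hprod : X ν * ∏ μ ∈ Finset.univ.erase ν, X μ = ∏ μ, X μ :=
    Finset.mul_prod_erase Finset.univ X (Finset.mem_univ ν)
  have hprod' : ∏ μ, X μ = (2 / Real.sqrt (1 + s)) ^ d *
      Real.exp (∑ μ, (2 * s * Real.cosh (a μ) - a μ * ((y μ).natAbs : ℝ))) := by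
    rw [hX]
    simp only []
    rw [Finset.prod_mul_distrib, Finset.prod_const, Finset.card_univ, Fintype.card_fin, Real.exp_sum]
  calc |G s (y ν + 1) - G s (y ν)| * |∏ μ ∈ Finset.univ.erase ν, G s (y μ)|
      ≤ (X ν * (5 / (4 * Real.sqrt (1 + s)) + (Real.exp (a ν) - 1))) * ∏ μ ∈ Finset.univ.erase ν, X μ :=
        mul_le_mul hν hrest (abs_nonneg _) (mul_nonneg (hXnn ν) hextra)
    _ = (X ν * ∏ μ ∈ Finset.univ.erase ν, X μ) * (5 / (4 * Real.sqrt (1 + s)) + (Real.exp (a ν) - 1)) := by ring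
    _ = _ := by rw [hprod, hprod']

/-- kernel: e² ≤ 7.39. [folklore] -/
private theorem exp_two_le : Real.exp 2 ≤ 7.39 := by
  have he := Real.exp_one_lt_d9
  have h2 : Real.exp 2 = Real.exp 1 * Real.exp 1 := by rw [← Real.exp_add]; norm_num
  rw [h2]; nlinarith [Real.exp_pos 1]

/-- kernel (chord of the convex exponential on [0,2]): e^a − 1 ≤ (16/5)·a for 0 ≤ a ≤ 2 ((e²−1)/2 ≤ 3.2). [folklore] -/
private theorem exp_sub_one_le_chord {a : ℝ} (h0 : 0 ≤ a) (h2 : a ≤ 2) : Real.exp a - 1 ≤ 16 / 5 * a := by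
  have hconv := convexOn_exp.2 (Set.mem_univ (0 : ℝ)) (Set.mem_univ (2 : ℝ)) (by linarith : 0 ≤ 1 - a / 2)
    (by linarith : 0 ≤ a / 2) (by ring)
  simp only [smul_eq_mul, mul_zero, zero_add, Real.exp_zero, mul_one] at hconv
  have h : (a / 2) * 2 = a := by ring
  rw [h] at hconv
  nlinarith [exp_two_le]

/-- kernel (both regimes, d = 3): for s > 0, y ∈ ℤ³, μ₀ a largest coordinate and any direction ν,
|ΔQ(s)(y)| ≤ (2/√(1+s))³·[exp(6s − (5/28)R²(y)/s)·(5/(4√(1+s)) + (8/7)|y_ν|/s) + 8·exp(6s − |y_{μ₀}|)] — the Gaussian tilts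
a_μ = 5|y_μ|/(14s) (with e^{a_ν} − 1 ≤ (16/5)a_ν) if 5|y_{μ₀}| ≤ 28s, the tilt 2 at μ₀ (extra factor ≤ 5/4 + e² − 1 ≤ 8) otherwise.
[cite: Balaban1983Higgs3, (3.16) p.437] -/
theorem dQ_three_le {s : ℝ} (hs : 0 < s) (y : ZSite 3) (ν : Fin 3) (μ₀ : Fin 3)
    (hmax : ∀ μ, (y μ).natAbs ≤ (y μ₀).natAbs) :
    |Q s (y + unitVec ν) - Q s y| ≤ (2 / Real.sqrt (1 + s)) ^ 3 *
      (Real.exp (6 * s - 5 / 28 * rsq y / s) * (5 / (4 * Real.sqrt (1 + s)) + 8 / 7 * ((y ν).natAbs : ℝ) / s)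
        + 8 * Real.exp (6 * s - ((y μ₀).natAbs : ℝ))) := by
  have hpref : 0 ≤ (2 / Real.sqrt (1 + s)) ^ 3 := by positivity
  have hsq1 : 1 ≤ Real.sqrt (1 + s) := by
    calc (1 : ℝ) = Real.sqrt 1 := Real.sqrt_one.symm
      _ ≤ Real.sqrt (1 + s) := Real.sqrt_le_sqrt (by linarith)
  have hsq : 0 < Real.sqrt (1 + s) := by linarith
  have h54 : 5 / (4 * Real.sqrt (1 + s)) ≤ 5 / 4 := by
    rw [div_le_div_iff_of_pos_left (by norm_num) (by positivity) (by norm_num)]; linarith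
  have hA0 : 0 ≤ Real.exp (6 * s - 5 / 28 * rsq y / s) * (5 / (4 * Real.sqrt (1 + s)) + 8 / 7 * ((y ν).natAbs : ℝ) / s) := by
    positivity
  have hB0 : 0 ≤ 8 * Real.exp (6 * s - ((y μ₀).natAbs : ℝ)) := by positivity
  rcases le_or_gt (5 * ((y μ₀).natAbs : ℝ)) (28 * s) with h1 | h2
  · -- Gaussian regime
    have hall : ∀ μ, 5 * ((y μ).natAbs : ℝ) ≤ 28 * s := fun μ => by
      have : ((y μ).natAbs : ℝ) ≤ ((y μ₀).natAbs : ℝ) := by exact_mod_cast hmax μ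
      linarith
    have hQ := dQ_le_tilt hs.le y ν (fun μ => 5 * ((y μ).natAbs : ℝ) / (14 * s)) (fun μ => by positivity)
    have hE := sum_tilt_gauss hs y hall
    push_cast at hE
    have haν2 : 5 * ((y ν).natAbs : ℝ) / (14 * s) ≤ 2 := by
      rw [div_le_iff₀ (by positivity)]; linarith [hall ν]
    have hchord : Real.exp (5 * ((y ν).natAbs : ℝ) / (14 * s)) - 1 ≤ 8 / 7 * ((y ν).natAbs : ℝ) / s := by
      refine (exp_sub_one_le_chord (by positivity) haν2).trans_eq ?_
      field_simp; ring
    have hex0 : 0 ≤ 5 / (4 * Real.sqrt (1 + s)) + (Real.exp (5 * ((y ν).natAbs : ℝ) / (14 * s)) - 1) := by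
      have := Real.one_le_exp (show 0 ≤ 5 * ((y ν).natAbs : ℝ) / (14 * s) by positivity)
      have : 0 ≤ 5 / (4 * Real.sqrt (1 + s)) := by positivity
      linarith
    calc |Q s (y + unitVec ν) - Q s y| ≤ _ := hQ
      _ ≤ (2 / Real.sqrt (1 + s)) ^ 3 * (Real.exp (6 * s - 5 / 28 * rsq y / s) *
            (5 / (4 * Real.sqrt (1 + s)) + 8 / 7 * ((y ν).natAbs : ℝ) / s)) := by
          rw [mul_assoc]
          refine mul_le_mul_of_nonneg_left ?_ hpref
          refine mul_le_mul (Real.exp_le_exp.mpr (by linarith)) (by linarith) hex0 (Real.exp_pos _).le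
      _ ≤ _ := by
          refine mul_le_mul_of_nonneg_left ?_ hpref
          linarith
  · -- large-coordinate regime
    have hQ := dQ_le_tilt hs.le y ν (fun μ => if μ = μ₀ then 2 else 0) (fun μ => by split_ifs <;> norm_num)
    have hE := sum_tilt_max hs.le y μ₀ h2
    push_cast at hE
    have hex0 : 0 ≤ 5 / (4 * Real.sqrt (1 + s)) + (Real.exp (if ν = μ₀ then 2 else 0) - 1) := by
      have := Real.one_le_exp (show (0 : ℝ) ≤ (if ν = μ₀ then 2 else 0) by split_ifs <;> norm_num)
      have : 0 ≤ 5 / (4 * Real.sqrt (1 + s)) := by positivity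
      linarith
    have hextra : 5 / (4 * Real.sqrt (1 + s)) + (Real.exp (if ν = μ₀ then 2 else 0) - 1) ≤ 8 := by
      have : Real.exp (if ν = μ₀ then 2 else 0) ≤ Real.exp 2 := Real.exp_le_exp.mpr (by split_ifs <;> norm_num)
      linarith [exp_two_le]
    calc |Q s (y + unitVec ν) - Q s y| ≤ _ := hQ
      _ ≤ (2 / Real.sqrt (1 + s)) ^ 3 * (Real.exp (6 * s - ((y μ₀).natAbs : ℝ)) * 8) := by
          rw [mul_assoc]
          refine mul_le_mul_of_nonneg_left ?_ hpref
          exact mul_le_mul (Real.exp_le_exp.mpr (by linarith)) hextra hex0 (Real.exp_pos _).le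
      _ ≤ _ := by
          refine mul_le_mul_of_nonneg_left ?_ hpref
          linarith

/-! ## 3. Pointwise bound for the difference of the Poissonized integrands on ξℤ³ -/

/-- kernel: θ = (6+ξ²)^{−1} > 0. [folklore] -/
private theorem theta3_pos (hξ : 0 < ξ) : 0 < hopWeight 3 ξ := by
  unfold hopWeight; positivity

/-- kernel: 6θ = 1 − θξ² for θ = (6+ξ²)^{−1}. [folklore] -/
private theorem six_theta3 (hξ : 0 < ξ) : 6 * hopWeight 3 ξ = 1 - hopWeight 3 ξ * ξ ^ 2 := by
  have h : hopWeight 3 ξ * (2 * ((3 : ℕ) : ℝ) + ξ ^ 2) = 1 := by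
    unfold hopWeight; exact inv_mul_cancel₀ (by positivity)
  push_cast at h
  linarith

/-- kernel (completing the square): x R/2 + R²/(14u) ≤ x²u + (5/28)R²/u for u > 0. [folklore] -/
private theorem complete_square {u x R : ℝ} (hu : 0 < u) :
    x * R / 2 + R ^ 2 / (14 * u) ≤ x ^ 2 * u + 5 / 28 * R ^ 2 / u := by
  have hu' := hu.ne'
  have e : x ^ 2 * u + 5 / 28 * R ^ 2 / u - (x * R / 2 + R ^ 2 / (14 * u))
      = ((x * u - R / 4) ^ 2 + 5 / 112 * R ^ 2) / u := by
    field_simp; ring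
  have : 0 ≤ x ^ 2 * u + 5 / 28 * R ^ 2 / u - (x * R / 2 + R ^ 2 / (14 * u)) := by
    rw [e]; positivity
  linarith

/-- kernel: (2/√(1+u))³ ≤ 8u^{−3/2} for u > 0. [folklore] -/
private theorem pref_le_rpow {u : ℝ} (hu : 0 < u) : (2 / Real.sqrt (1 + u)) ^ 3 ≤ 8 * u ^ (-(3 / 2 : ℝ)) := by
  have hsu : 0 < Real.sqrt u := Real.sqrt_pos.mpr hu
  have hle : Real.sqrt u ≤ Real.sqrt (1 + u) := Real.sqrt_le_sqrt (by linarith)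
  have h1 : 2 / Real.sqrt (1 + u) ≤ 2 / Real.sqrt u := div_le_div_of_nonneg_left (by norm_num) hsu hle
  have h1' : (2 / Real.sqrt (1 + u)) ^ 3 ≤ (2 / Real.sqrt u) ^ 3 := pow_le_pow_left₀ (by positivity) h1 3
  have h2 : (2 / Real.sqrt u) ^ 3 = 8 * u ^ (-(3 / 2 : ℝ)) := by
    rw [div_pow, Real.rpow_neg hu.le, Real.sqrt_eq_rpow, ← Real.rpow_natCast (u ^ (1 / (2 : ℝ))) 3,
      ← Real.rpow_mul hu.le]
    norm_num [div_eq_mul_inv]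
  linarith [h2.le]

/-- kernel: (2/√(1+u))³·(5/(4√(1+u))) ≤ 10·u^{−2} for u > 0 ((2/√(1+u))⁴·5/8 = 10/(1+u)²). [folklore] -/
private theorem pref_mul_le_rpow_two {u : ℝ} (hu : 0 < u) :
    (2 / Real.sqrt (1 + u)) ^ 3 * (5 / (4 * Real.sqrt (1 + u))) ≤ 10 * u ^ (-(2 : ℝ)) := by
  have h1u : 0 < 1 + u := by linarith
  have hsq : 0 < Real.sqrt (1 + u) := Real.sqrt_pos.mpr h1u
  have hsq2 : Real.sqrt (1 + u) ^ 2 = 1 + u := Real.sq_sqrt h1u.le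
  have e1 : (2 / Real.sqrt (1 + u)) ^ 3 * (5 / (4 * Real.sqrt (1 + u))) = 10 / (1 + u) ^ 2 := by
    set w := Real.sqrt (1 + u) with hw
    rw [← hsq2]; field_simp; ring
  have e2 : (10 : ℝ) * u ^ (-(2 : ℝ)) = 10 / u ^ 2 := by
    rw [Real.rpow_neg hu.le, Real.rpow_two]; ring
  rw [e1, e2]
  have hu2 : u ^ 2 ≤ (1 + u) ^ 2 := by nlinarith
  exact div_le_div_of_nonneg_left (by norm_num) (by positivity) hu2

/-- kernel: (2/√(1+u))³·(c/u) ≤ 8c·u^{−5/2} for u > 0, c ≥ 0. [folklore] -/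
private theorem pref_mul_le_rpow_five_halves {u c : ℝ} (hu : 0 < u) (hc : 0 ≤ c) :
    (2 / Real.sqrt (1 + u)) ^ 3 * (c / u) ≤ 8 * c * u ^ (-(5 / 2 : ℝ)) := by
  have hp := pref_le_rpow hu
  have e : u ^ (-(5 / 2 : ℝ)) = u ^ (-(3 / 2 : ℝ)) * u⁻¹ := by
    rw [← Real.rpow_neg_one, ← Real.rpow_add hu]; norm_num
  rw [e, div_eq_mul_inv c]
  calc (2 / Real.sqrt (1 + u)) ^ 3 * (c * u⁻¹) ≤ 8 * u ^ (-(3 / 2 : ℝ)) * (c * u⁻¹) :=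
        mul_le_mul_of_nonneg_right hp (by positivity)
    _ = 8 * c * (u ^ (-(3 / 2 : ℝ)) * u⁻¹) := by ring

/-- kernel: the difference of the integrands is e^{−t}·ΔQ(θt)(y). [cite: Balaban1983Higgs3, (3.16) p.437] -/
theorem integrand_succ_sub (ξ : ℝ) (y : ZSite d) (ν : Fin d) (t : ℝ) :
    integrand d ξ (y + unitVec ν) t - integrand d ξ y t =
      Real.exp (-t) * (Q (hopWeight d ξ * t) (y + unitVec ν) - Q (hopWeight d ξ * t) y) := by
  unfold integrand; ring

/-- kernel: for t > 0, y ∈ ℤ³, μ₀ a largest coordinate, ν any direction, R² = Σ|y_μ|², R = √R², N = |y_{μ₀}|, θ = (6+ξ²)^{−1}: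
|e^{−t}ΔQ(θt)(y)| ≤ e^{−ξR/2}·[10(θt)^{−2}e^{−(R²/14)/(θt)} + (64/7)|y_ν|(θt)^{−5/2}e^{−(R²/14)/(θt)}] + 8e^{−N}·(2/√(1+θt))³ — the two
regimes of `dQ_three_le`, e^{−t+6θt} = e^{−ξ²θt}, completing the square ξ²u + (5/28)R²/u ≥ ξR/2 + R²/(14u), and the prefactor
bounds (2/√(1+u))³·5/(4√(1+u)) ≤ 10u^{−2}, (2/√(1+u))³·(8/7)|y_ν|/u ≤ (64/7)|y_ν|u^{−5/2}. [cite: Balaban1983Higgs3, (3.16) p.437] -/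
theorem abs_integrand_succ_sub_three_le (hξ : 0 < ξ) (y : ZSite 3) (ν : Fin 3) (μ₀ : Fin 3)
    (hmax : ∀ μ, (y μ).natAbs ≤ (y μ₀).natAbs) {t : ℝ} (ht : 0 < t) :
    |integrand 3 ξ (y + unitVec ν) t - integrand 3 ξ y t| ≤
      Real.exp (-(ξ * Real.sqrt (rsq y) / 2)) *
          (10 * ((hopWeight 3 ξ * t) ^ (-(2 : ℝ)) * Real.exp (-(rsq y / 14) / (hopWeight 3 ξ * t)))
            + 64 / 7 * ((y ν).natAbs : ℝ) *
              ((hopWeight 3 ξ * t) ^ (-(5 / 2 : ℝ)) * Real.exp (-(rsq y / 14) / (hopWeight 3 ξ * t))))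
        + 8 * Real.exp (-((y μ₀).natAbs : ℝ)) * (2 / Real.sqrt (1 + hopWeight 3 ξ * t)) ^ 3 := by
  have hθ : 0 < hopWeight 3 ξ := theta3_pos hξ
  have h6 := six_theta3 hξ
  have hs : 0 < hopWeight 3 ξ * t := mul_pos hθ ht
  have hQ := dQ_three_le hs y ν μ₀ hmax
  have hR2 : Real.sqrt (rsq y) ^ 2 = rsq y := Real.sq_sqrt (rsq_nonneg y)
  have hcs := complete_square (x := ξ) (R := Real.sqrt (rsq y)) hs
  rw [hR2] at hcs
  rw [integrand_succ_sub, abs_mul, abs_of_pos (Real.exp_pos _)]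
  set s := hopWeight 3 ξ * t with hsdef
  set R := Real.sqrt (rsq y) with hRdef
  set N : ℝ := ((y μ₀).natAbs : ℝ) with hNdef
  set n : ℝ := ((y ν).natAbs : ℝ) with hndef
  have hn : 0 ≤ n := Nat.cast_nonneg _
  have hpA := pref_mul_le_rpow_two hs
  have hpB := pref_mul_le_rpow_five_halves hs (show (0 : ℝ) ≤ 8 / 7 * n by positivity)
  have hexp : -t + 6 * s = -(ξ ^ 2 * s) := by
    rw [hsdef]
    have : -t + 6 * (hopWeight 3 ξ * t) = -((1 - 6 * hopWeight 3 ξ) * t) := by ring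
    rw [this, h6]; ring
  have hpref : 0 ≤ (2 / Real.sqrt (1 + s)) ^ 3 := by positivity
  set P := (2 / Real.sqrt (1 + s)) ^ 3 with hPdef
  set Eq : ℝ := Real.exp (-(rsq y / 14) / s) with hEq
  have hEq0 : 0 < Eq := Real.exp_pos _
  -- step 1: insert `dQ_three_le` and absorb e^{−t}
  have step1 : Real.exp (-t) * |Q s (y + unitVec ν) - Q s y| ≤
      P * (Real.exp (-(ξ ^ 2 * s) - 5 / 28 * rsq y / s) * (5 / (4 * Real.sqrt (1 + s)) + 8 / 7 * n / s)
        + 8 * Real.exp (-(ξ ^ 2 * s) - N)) := by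
    calc Real.exp (-t) * |Q s (y + unitVec ν) - Q s y|
        ≤ Real.exp (-t) * (P * (Real.exp (6 * s - 5 / 28 * rsq y / s) * (5 / (4 * Real.sqrt (1 + s)) + 8 / 7 * n / s)
            + 8 * Real.exp (6 * s - N))) := mul_le_mul_of_nonneg_left hQ (Real.exp_pos _).le
      _ = _ := by
          have e1 : Real.exp (-t) * Real.exp (6 * s - 5 / 28 * rsq y / s) = Real.exp (-(ξ ^ 2 * s) - 5 / 28 * rsq y / s) := by
            rw [← Real.exp_add]; congr 1; linarith
          have e2 : Real.exp (-t) * Real.exp (6 * s - N) = Real.exp (-(ξ ^ 2 * s) - N) := by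
            rw [← Real.exp_add]; congr 1; linarith
          rw [← e1, ← e2]; ring
  -- step 2: complete the square and drop e^{−ξ²s} in the second term
  have hgauss : Real.exp (-(ξ ^ 2 * s) - 5 / 28 * rsq y / s) ≤ Real.exp (-(ξ * R / 2)) * Eq := by
    rw [hEq, ← Real.exp_add]
    refine Real.exp_le_exp.mpr ?_
    have e3 : -(rsq y / 14) / s = -(rsq y / (14 * s)) := by rw [neg_div, div_div]
    rw [e3]
    linarith
  have hmax' : Real.exp (-(ξ ^ 2 * s) - N) ≤ Real.exp (-N) :=
    Real.exp_le_exp.mpr (by linarith [mul_nonneg (sq_nonneg ξ) hs.le])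
  have hextra : 0 ≤ 5 / (4 * Real.sqrt (1 + s)) + 8 / 7 * n / s := by positivity
  have step2 : P * (Real.exp (-(ξ ^ 2 * s) - 5 / 28 * rsq y / s) * (5 / (4 * Real.sqrt (1 + s)) + 8 / 7 * n / s)
        + 8 * Real.exp (-(ξ ^ 2 * s) - N))
      ≤ Real.exp (-(ξ * R / 2)) * (Eq * (P * (5 / (4 * Real.sqrt (1 + s))) + P * (8 / 7 * n / s)))
        + 8 * Real.exp (-N) * P := by
    have h1 : P * (Real.exp (-(ξ ^ 2 * s) - 5 / 28 * rsq y / s) * (5 / (4 * Real.sqrt (1 + s)) + 8 / 7 * n / s))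
        ≤ P * ((Real.exp (-(ξ * R / 2)) * Eq) * (5 / (4 * Real.sqrt (1 + s)) + 8 / 7 * n / s)) :=
      mul_le_mul_of_nonneg_left (mul_le_mul_of_nonneg_right hgauss hextra) hpref
    have h2 : P * (8 * Real.exp (-(ξ ^ 2 * s) - N)) ≤ P * (8 * Real.exp (-N)) :=
      mul_le_mul_of_nonneg_left (by linarith) hpref
    have e : P * ((Real.exp (-(ξ * R / 2)) * Eq) * (5 / (4 * Real.sqrt (1 + s)) + 8 / 7 * n / s)) + P * (8 * Real.exp (-N))
        = Real.exp (-(ξ * R / 2)) * (Eq * (P * (5 / (4 * Real.sqrt (1 + s))) + P * (8 / 7 * n / s)))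
          + 8 * Real.exp (-N) * P := by ring
    rw [mul_add, ← e]
    exact add_le_add h1 h2
  -- step 3: the prefactor bounds
  have step3 : Eq * (P * (5 / (4 * Real.sqrt (1 + s))) + P * (8 / 7 * n / s))
      ≤ 10 * (s ^ (-(2 : ℝ)) * Eq) + 64 / 7 * n * (s ^ (-(5 / 2 : ℝ)) * Eq) := by
    have h := add_le_add hpA hpB
    have h' := mul_le_mul_of_nonneg_left h hEq0.le
    refine h'.trans_eq ?_
    ring
  have hE1 : 0 ≤ Real.exp (-(ξ * R / 2)) := (Real.exp_pos _).le
  calc Real.exp (-t) * |Q s (y + unitVec ν) - Q s y| ≤ _ := step1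
    _ ≤ _ := step2
    _ ≤ _ := by
        have := mul_le_mul_of_nonneg_left step3 hE1
        linarith

end

end Literature.MathematicalPhysics.QuantumFieldTheory.Balaban1983to89.B3CxiDifferenceKernel
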